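import Summits.HubbardSuperconductivity.HubbardSuperconductivity.Theorems.SoloBlindCertificateFromGroundGap
import HarnessLib

/-!
# The robust target: uniform d-wave order on a low-energy spectral window

`SoloBlindOrderNotEnergyRobust` shows that no hypothesis stable under `O(1)` perturbations of the
energy EXPECTATION can imply the summit (twisted ground states: energy `E₀ + O(|t|)`, order
`< cL⁴/2`). The natural robust strengthening is SPECTRAL instead: uniform order on the whole
low-energy spectral subspace of the sector,

  `R1⁺(ε, a)`: for every `H`-invariant subspace `W ≤ S` on which `re⟨w, H w⟩ ≤ (E₀ + ε)‖w‖²`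
  (equivalently: every eigenvalue of `H|_W` is `≤ E₀ + ε`), `a‖w‖² ≤ ‖A w‖²` for all `w ∈ W`

(`S` an `H`-invariant sector, `E₀ ≤ H` on `S`, `A` the order field, here `√2 Δ_d`). With `ε = 0`
(indeed with `W` = the ground eigenspace) this is requirement R1, so `R1⁺` at every large even side
implies `HubbardSuperconductivity` (`hubbardSuperconductivity_of_window_order`). The point of this
file is the equivalence, up to constants, of `R1⁺` with an `L`-INDEPENDENT window `ε > 0` and the
positive-semidefinite certificate of `SoloBlindCertificateForm` with the MINIMAL admissible order of
multiplier `κ = Θ(L⁴)` (`SoloBlindCertificateForm` proves `κ ≥ (c/2ε(c,t))L⁴` necessary):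

* `certificate_of_window_order` (abstract) / `certificate_of_dWave_window_order` (Hubbard torus):
  `R1⁺(ε, a)` with `ε > 0` gives `(a/2)‖φ‖² ≤ ‖Aφ‖² + ((B + a/2)/ε)(re⟨φ,Hφ⟩ - E₀‖φ‖²)` on `S`
  (`B = 400L⁴` for `|g| ≤ 1`), i.e. a certificate with `κ = (400L⁴ + a/2)/ε`;
* `window_order_of_certificate`: a certificate with multiplier `κ ≥ 0` and constant `a` gives
  `R1⁺(ε, a - κε)` for every `ε` (no invariance needed).

Ingredient (`exists_low_window_split`, the finite-dimensional spectral theorem in the form needed,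
proved by induction on `dim S` with `exists_unit_eigen_minEnergyOn`): for every real `E` the sector
splits as `W ⊕ (S ⊖ W)` with `W` `H`-invariant, `re⟨w,Hw⟩ ≤ E‖w‖²` on `W` and `re⟨q,Hq⟩ ≥ E‖q‖²` on
`S ⊖ W`.

References: Reed–Simon IV §XIII.1 (min-max); `SoloBlindCertificateForm`,
`SoloBlindCertificateFromGap` (`certificate_of_orthogonal_split`), `SoloBlindFiniteVolumeCriterion`.
-/

namespace Summit.HubbardSuperconductivity.HubbardSuperconductivity.Theorems

open Matrix Finset Literature.Probability.LatticeModels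
  Literature.MathematicalPhysics.QuantumLattice Literature.MathematicalPhysics.QuantumFieldTheory
  GaugeTwist WithLp
open scoped ComplexConjugate ComplexOrder InnerProductSpace

section Abstract

variable {n : Type*} [Fintype n]

/-- Orthogonal decomposition along an arbitrary subspace `W`, in `dotProduct` language:
`φ = u + w` with `u ∈ W` and `w` orthogonal to `W`. [folklore] -/
theorem exists_mem_add_orthogonal (W : Submodule ℂ (n → ℂ)) (φ : n → ℂ) :
    ∃ u w : n → ℂ, φ = u + w ∧ u ∈ W ∧ ∀ ψ ∈ W, star ψ ⬝ᵥ w = 0 := by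
  let K : Submodule ℂ (EuclideanSpace ℂ n) := W.comap (WithLp.linearEquiv 2 ℂ (n → ℂ)).toLinearMap
  have hmem : ∀ y : EuclideanSpace ℂ n, y ∈ K ↔ ofLp y ∈ W := fun _ => Iff.rfl
  set x : EuclideanSpace ℂ n := toLp 2 φ with hx
  have huK : K.starProjection x ∈ K := K.starProjection_apply_mem x
  have hwK : x - K.starProjection x ∈ Kᗮ := K.sub_starProjection_mem_orthogonal x
  rw [hmem] at huK
  refine ⟨ofLp (K.starProjection x), ofLp (x - K.starProjection x), ?_, huK, ?_⟩
  · rw [← ofLp_add, add_sub_cancel, hx, ofLp_toLp]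
  · intro ψ hψ
    have hψK : (toLp 2 ψ : EuclideanSpace ℂ n) ∈ K := by rw [hmem, ofLp_toLp]; exact hψ
    have h0 := (Submodule.mem_orthogonal K _).1 hwK _ hψK
    rw [EuclideanSpace.inner_eq_star_dotProduct, dotProduct_comm, ofLp_toLp] at h0
    exact h0

/-- If `H` is Hermitian, `H u = E • u` and `⟨u, q⟩ = 0`, then `⟨u, H q⟩ = 0`. [folklore] -/
theorem star_dotProduct_mulVec_eq_zero_of_eigen {H : Matrix n n ℂ} (hH : H.IsHermitian)
    {u q : n → ℂ} {E : ℂ} (hu : H *ᵥ u = E • u) (h0 : star u ⬝ᵥ q = 0) :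
    star u ⬝ᵥ (H *ᵥ q) = 0 := by
  rw [dotProduct_mulVec, ← hH.eq, ← star_mulVec, hu, star_smul, smul_dotProduct, h0, smul_zero]

/-- The trivial window: if `E‖q‖² ≤ re⟨q,Hq⟩` on all of `S`, take `W = ⊥`. [folklore] -/
theorem exists_low_window_split_of_le (H : Matrix n n ℂ) (S : Submodule ℂ (n → ℂ)) (E : ℝ)
    (h : ∀ q ∈ S, E * (star q ⬝ᵥ q).re ≤ (star q ⬝ᵥ (H *ᵥ q)).re) :
    ∃ W : Submodule ℂ (n → ℂ), W ≤ S ∧ (∀ w ∈ W, H *ᵥ w ∈ W) ∧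
      (∀ w ∈ W, (star w ⬝ᵥ (H *ᵥ w)).re ≤ E * (star w ⬝ᵥ w).re) ∧
      (∀ q ∈ S, (∀ w ∈ W, star w ⬝ᵥ q = 0) → E * (star q ⬝ᵥ q).re ≤ (star q ⬝ᵥ (H *ᵥ q)).re) := by
  refine ⟨⊥, bot_le, ?_, ?_, fun q hq _ => h q hq⟩
  · intro w hw
    rw [(Submodule.mem_bot ℂ).1 hw, mulVec_zero]
    exact Submodule.zero_mem _
  · intro w hw
    rw [(Submodule.mem_bot ℂ).1 hw]
    simp

/-- **Low-energy spectral window** (finite-dimensional spectral theorem, the part needed): for a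
Hermitian `H`, an `H`-invariant subspace `S` and any real `E`, there is an `H`-invariant `W ≤ S`
with `re⟨w,Hw⟩ ≤ E‖w‖²` on `W` and `E‖q‖² ≤ re⟨q,Hq⟩` for every `q ∈ S` orthogonal to `W`.
Induction on `dim S`, peeling off a lowest eigenvector (`exists_unit_eigen_minEnergyOn`).
[folklore] -/
theorem exists_low_window_split [DecidableEq n] {H : Matrix n n ℂ} (hH : H.IsHermitian) (E : ℝ) :
    ∀ (k : ℕ) (S : Submodule ℂ (n → ℂ)), Module.finrank ℂ S ≤ k → (∀ v ∈ S, H *ᵥ v ∈ S) →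
      ∃ W : Submodule ℂ (n → ℂ), W ≤ S ∧ (∀ w ∈ W, H *ᵥ w ∈ W) ∧
        (∀ w ∈ W, (star w ⬝ᵥ (H *ᵥ w)).re ≤ E * (star w ⬝ᵥ w).re) ∧
        (∀ q ∈ S, (∀ w ∈ W, star w ⬝ᵥ q = 0) →
          E * (star q ⬝ᵥ q).re ≤ (star q ⬝ᵥ (H *ᵥ q)).re) := by
  intro k
  induction k with
  | zero =>
    intro S hk _
    have hS : S = ⊥ := Submodule.finrank_eq_zero.1 (Nat.le_zero.1 hk)
    refine exists_low_window_split_of_le H S E fun q hq => ?_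
    rw [hS] at hq
    rw [(Submodule.mem_bot ℂ).1 hq]
    simp
  | succ k ih =>
    intro S hk hinv
    by_cases hS : S = ⊥
    · refine exists_low_window_split_of_le H S E fun q hq => ?_
      rw [hS] at hq
      rw [(Submodule.mem_bot ℂ).1 hq]
      simp
    obtain ⟨v, hvS, hv1, hv⟩ := exists_unit_eigen_minEnergyOn hH S hinv hS
    set μ : ℝ := H.minEnergyOn S with hμ
    by_cases hE : E < μ
    · -- the whole sector lies above `E`
      refine exists_low_window_split_of_le H S E fun q hq => ?_
      have h1 := minEnergyOn_mul_le_re_rayleigh hH S hq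
      have hq0 := (Complex.nonneg_iff.mp (dotProduct_star_self_nonneg q)).1
      have h2 : E * (star q ⬝ᵥ q).re ≤ μ * (star q ⬝ᵥ q).re :=
        mul_le_mul_of_nonneg_right hE.le hq0
      exact h2.trans h1
    have hμE : μ ≤ E := not_lt.1 hE
    -- peel off `v`: the part of `S` orthogonal to `v`
    let S' : Submodule ℂ (n → ℂ) :=
      { carrier := {q | q ∈ S ∧ star v ⬝ᵥ q = 0}
        zero_mem' := ⟨S.zero_mem, dotProduct_zero _⟩
        add_mem' := by
          rintro a b ⟨ha, ha0⟩ ⟨hb, hb0⟩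
          exact ⟨S.add_mem ha hb, by rw [dotProduct_add, ha0, hb0, add_zero]⟩
        smul_mem' := by
          rintro c a ⟨ha, ha0⟩
          exact ⟨S.smul_mem c ha, by rw [dotProduct_smul, ha0, smul_zero]⟩ }
    have hmem' : ∀ q, q ∈ S' ↔ q ∈ S ∧ star v ⬝ᵥ q = 0 := fun _ => Iff.rfl
    have hS'le : S' ≤ S := fun q hq => hq.1
    have hinv' : ∀ q ∈ S', H *ᵥ q ∈ S' := by
      intro q hq
      exact ⟨hinv q hq.1, star_dotProduct_mulVec_eq_zero_of_eigen hH hv hq.2⟩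
    have hvS' : v ∉ S' := by
      intro h
      have := h.2
      rw [hv1] at this
      exact one_ne_zero this
    have hlt : S' < S := SetLike.lt_iff_le_and_exists.2 ⟨hS'le, v, hvS, hvS'⟩
    have hk' : Module.finrank ℂ S' ≤ k := by
      have := Submodule.finrank_lt_finrank_of_lt hlt
      omega
    obtain ⟨W', hW'le, hW'inv, hW'low, hW'high⟩ := ih S' hk' hinv'
    -- the window: `span {v} ⊔ W'`
    refine ⟨(ℂ ∙ v) ⊔ W', ?_, ?_, ?_, ?_⟩
    · refine sup_le ?_ (hW'le.trans hS'le)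
      rw [Submodule.span_le, Set.singleton_subset_iff]
      exact hvS
    · intro w hw
      obtain ⟨y, hy, z, hz, rfl⟩ := Submodule.mem_sup.1 hw
      obtain ⟨a, rfl⟩ := Submodule.mem_span_singleton.1 hy
      rw [mulVec_add, mulVec_smul, hv]
      exact Submodule.add_mem_sup
        (Submodule.smul_mem _ a (Submodule.smul_mem _ _ (Submodule.mem_span_singleton_self v)))
        (hW'inv z hz)
    · intro w hw
      obtain ⟨y, hy, z, hz, rfl⟩ := Submodule.mem_sup.1 hw
      obtain ⟨a, rfl⟩ := Submodule.mem_span_singleton.1 hy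
      have hvz : star v ⬝ᵥ z = 0 := (hW'le hz).2
      have horth : star (a • v) ⬝ᵥ z = 0 := by
        rw [star_smul, smul_dotProduct, hvz, smul_zero]
      have hu : H *ᵥ (a • v) = ((μ : ℝ) : ℂ) • (a • v) := by
        rw [mulVec_smul, hv, smul_comm]
      have h1 := re_energy_above_eigen_add_orthogonal hH (a • v) z μ hu horth
      have h2 := re_add_self_of_orthogonal (a • v) z (by rw [horth, Complex.zero_re])
      have h3 := hW'low z hz
      have hy0 := (Complex.nonneg_iff.mp (dotProduct_star_self_nonneg (a • v))).1
      have h4 : μ * (star (a • v) ⬝ᵥ (a • v)).re ≤ E * (star (a • v) ⬝ᵥ (a • v)).re :=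
        mul_le_mul_of_nonneg_right hμE hy0
      nlinarith
    · intro q hq horth
      have hvq : star v ⬝ᵥ q = 0 :=
        horth v (Submodule.mem_sup_left (Submodule.mem_span_singleton_self v))
      exact hW'high q ⟨hq, hvq⟩ fun w hw => horth w (Submodule.mem_sup_right hw)

/-- **Certificate from uniform order on a spectral window** (abstract). `H` Hermitian, `S` an
`H`-invariant subspace with `E₀‖φ‖² ≤ re⟨φ,Hφ⟩` on `S`, `A` any matrix with `‖Aw‖² ≤ B‖w‖²`,
`ε > 0`, `a ≥ 0`. If `a‖w‖² ≤ ‖Aw‖²` on every `H`-invariant `W ≤ S` whose Rayleigh quotients are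
`≤ E₀ + ε`, then every `φ ∈ S` satisfies the certificate
`(a/2)‖φ‖² ≤ ‖Aφ‖² + ((B + a/2)/ε)(re⟨φ,Hφ⟩ - E₀‖φ‖²)`. [this work] -/
theorem certificate_of_window_order [DecidableEq n] {H : Matrix n n ℂ} (hH : H.IsHermitian)
    (A : Matrix n n ℂ) (S : Submodule ℂ (n → ℂ)) (hS : ∀ v ∈ S, H *ᵥ v ∈ S) (E₀ ε a B : ℝ)
    (hε : 0 < ε)
    (ha : 0 ≤ a) (hB0 : 0 ≤ B)
    (hE₀ : ∀ φ ∈ S, E₀ * (star φ ⬝ᵥ φ).re ≤ (star φ ⬝ᵥ (H *ᵥ φ)).re)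
    (hB : ∀ w, (star (A *ᵥ w) ⬝ᵥ (A *ᵥ w)).re ≤ B * (star w ⬝ᵥ w).re)
    (hwin : ∀ W : Submodule ℂ (n → ℂ), W ≤ S → (∀ w ∈ W, H *ᵥ w ∈ W) →
      (∀ w ∈ W, (star w ⬝ᵥ (H *ᵥ w)).re ≤ (E₀ + ε) * (star w ⬝ᵥ w).re) →
      ∀ w ∈ W, a * (star w ⬝ᵥ w).re ≤ (star (A *ᵥ w) ⬝ᵥ (A *ᵥ w)).re) :
    ∀ φ ∈ S, a / 2 * (star φ ⬝ᵥ φ).re ≤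
      (star (A *ᵥ φ) ⬝ᵥ (A *ᵥ φ)).re +
        (B + a / 2) / ε * ((star φ ⬝ᵥ (H *ᵥ φ)).re - E₀ * (star φ ⬝ᵥ φ).re) := by
  obtain ⟨W, hWle, hWinv, hWlow, hWhigh⟩ :=
    exists_low_window_split hH (E₀ + ε) (Module.finrank ℂ S) S le_rfl hS
  intro φ hφ
  obtain ⟨u, w, hφuw, hu, horth⟩ := exists_mem_add_orthogonal W φ
  have huS : u ∈ S := hWle hu
  have hwS : w ∈ S := by
    have : w = φ - u := by rw [hφuw, add_sub_cancel_left]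
    rw [this]
    exact S.sub_mem hφ huS
  have huw : star u ⬝ᵥ w = 0 := horth u hu
  have hwu : star w ⬝ᵥ u = 0 := star_dotProduct_eq_zero_symm huw
  -- the cross terms of the energy vanish: `⟨u, H w⟩ = 0 = ⟨w, H u⟩`
  have hwHu : star w ⬝ᵥ (H *ᵥ u) = 0 := star_dotProduct_eq_zero_symm (horth _ (hWinv u hu))
  have huHw : star u ⬝ᵥ (H *ᵥ w) = 0 := by
    rw [dotProduct_mulVec, ← hH.eq, ← star_mulVec]
    exact horth _ (hWinv u hu)
  have hsplit : star (u + w) ⬝ᵥ (H *ᵥ (u + w)) = star u ⬝ᵥ (H *ᵥ u) + star w ⬝ᵥ (H *ᵥ w) := by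
    rw [mulVec_add, star_add, add_dotProduct, dotProduct_add, dotProduct_add, huHw, hwHu, add_zero,
      zero_add]
  have hsplit_re : (star (u + w) ⬝ᵥ (H *ᵥ (u + w))).re =
      (star u ⬝ᵥ (H *ᵥ u)).re + (star w ⬝ᵥ (H *ᵥ w)).re := by
    rw [hsplit, Complex.add_re]
  have hnorm := re_add_self_of_orthogonal u w (by rw [huw, Complex.zero_re])
  have h1 := hE₀ u huS
  have h2 := hWhigh w hwS horth
  have hgap : ε * (star w ⬝ᵥ w).re ≤
      (star φ ⬝ᵥ (H *ᵥ φ)).re - E₀ * (star φ ⬝ᵥ φ).re := by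
    rw [hφuw, hsplit_re, hnorm]
    nlinarith
  have h := certificate_of_orthogonal_split A u w a B ε _ hε (by positivity)
    (by rw [huw, Complex.zero_re]) (hwin W hWle hWinv hWlow u hu) (hB w) hgap
  rwa [← hφuw] at h

/-- **Converse**: a certificate with multiplier `κ ≥ 0` and constant `a` gives uniform order
`a - κε` on every subspace of `S` with Rayleigh quotients `≤ E₀ + ε` (invariance is not needed).
[this work] -/
theorem window_order_of_certificate (H A : Matrix n n ℂ) (S : Submodule ℂ (n → ℂ))
    (E₀ κ a ε : ℝ) (hκ : 0 ≤ κ)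
    (hcert : ∀ φ ∈ S, a * (star φ ⬝ᵥ φ).re ≤ (star (A *ᵥ φ) ⬝ᵥ (A *ᵥ φ)).re +
      κ * ((star φ ⬝ᵥ (H *ᵥ φ)).re - E₀ * (star φ ⬝ᵥ φ).re))
    (W : Submodule ℂ (n → ℂ)) (hW : W ≤ S)
    (hlow : ∀ w ∈ W, (star w ⬝ᵥ (H *ᵥ w)).re ≤ (E₀ + ε) * (star w ⬝ᵥ w).re) :
    ∀ w ∈ W, (a - κ * ε) * (star w ⬝ᵥ w).re ≤ (star (A *ᵥ w) ⬝ᵥ (A *ᵥ w)).re := by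
  intro w hw
  have h1 := hcert w (hW hw)
  have h2 := hlow w hw
  have h3 : κ * ((star w ⬝ᵥ (H *ᵥ w)).re - E₀ * (star w ⬝ᵥ w).re) ≤
      κ * (ε * (star w ⬝ᵥ w).re) := mul_le_mul_of_nonneg_left (by linarith) hκ
  nlinarith

end Abstract

section Hubbard

variable {L : ℕ} [NeZero L]

/-- **Certificate from uniform d-wave order on a spectral window** (Hubbard torus, any `t, U`, any
sector `S = szSector N Mz`, `E₀` its ground energy, form factor `|g| ≤ 1`, `ε > 0`, `a ≥ 0`): if
`a‖w‖² ≤ re⟨w, Δ_g†Δ_g w⟩` on every `H`-invariant `W ≤ S` with Rayleigh quotients `≤ E₀ + ε`, then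
the certificate of `hubbardSuperconductivity_iff_certificate` holds on `S` with constant `a/2` and
multiplier `κ = (400 L⁴ + a/2)/ε`. [this work] -/
theorem certificate_of_dWave_window_order (t U ε a : ℝ) (hε : 0 < ε) (ha : 0 ≤ a)
    (g : (Fin 2 → ℤ) → ℝ) (hg : ∀ e, |g e| ≤ 1) (N : ℕ) (Mz : ℝ)
    (hwin : ∀ W : Submodule ℂ (Fock (Orb (FermionTorus 2 L))),
      W ≤ szSector (Λ := FermionTorus 2 L) N Mz → (∀ w ∈ W, hubbardTorus 2 L t U *ᵥ w ∈ W) →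
      (∀ w ∈ W, (star w ⬝ᵥ (hubbardTorus 2 L t U *ᵥ w)).re ≤
        ((hubbardTorus 2 L t U).minEnergyOn (szSector N Mz) + ε) * (star w ⬝ᵥ w).re) →
      ∀ w ∈ W, a * (star w ⬝ᵥ w).re ≤
        (star (pairField g L *ᵥ w) ⬝ᵥ (pairField g L *ᵥ w)).re) :
    ∀ φ ∈ szSector (Λ := FermionTorus 2 L) N Mz, a / 2 * (star φ ⬝ᵥ φ).re ≤
      (star (pairField g L *ᵥ φ) ⬝ᵥ (pairField g L *ᵥ φ)).re +
        (400 * (L : ℝ) ^ 4 + a / 2) / ε *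
          ((star φ ⬝ᵥ (hubbardTorus 2 L t U *ᵥ φ)).re -
            (hubbardTorus 2 L t U).minEnergyOn (szSector N Mz) * (star φ ⬝ᵥ φ).re) := by
  have hH := isHermitian_hubbardTorus L t U
  exact certificate_of_window_order hH (pairField g L) (szSector (Λ := FermionTorus 2 L) N Mz)
    (fun v hv => hubbardTorus_mulVec_mem_szSector t U hv) _ ε a (400 * (L : ℝ) ^ 4) hε ha
    (by positivity) (fun φ hφ => minEnergyOn_mul_le_re_rayleigh hH _ hφ)
    (pairField_order_le g hg) hwin

/-- **The robust target implies the summit.** If for some `U > 0`, `δ ∈ (0,1/2)`, `c > 0` and all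
large even sides `L = n+1` there is `ε ≥ 0` such that `c L⁴‖w‖² ≤ re⟨w, (√2Δ_d)†(√2Δ_d) w⟩` holds on
every `H`-invariant subspace `W` of the doped `S^z = 0` sector with Rayleigh quotients `≤ E₀ + ε`
(`ε = 0` allowed: then only the ground eigenspace is constrained), then `HubbardSuperconductivity`.
[this work] -/
theorem hubbardSuperconductivity_of_window_order
    (h : ∃ U : ℝ, 0 < U ∧ ∃ δ ∈ Set.Ioo (0 : ℝ) (1 / 2), ∃ c : ℝ, 0 < c ∧ ∃ L₀ : ℕ,
      ∀ n : ℕ, Even (n + 1) → L₀ ≤ n + 1 → ∃ ε : ℝ, 0 ≤ ε ∧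
        ∀ W : Submodule ℂ (Fock (Orb (FermionTorus 2 (n + 1)))),
          W ≤ szSector (Λ := FermionTorus 2 (n + 1))
            (2 * ⌊(1 - δ) * ((n + 1 : ℕ) : ℝ) ^ 2 / 2⌋₊) 0 →
          (∀ w ∈ W, hubbardTorus 2 (n + 1) 1 U *ᵥ w ∈ W) →
          (∀ w ∈ W, (star w ⬝ᵥ (hubbardTorus 2 (n + 1) 1 U *ᵥ w)).re ≤
            ((hubbardTorus 2 (n + 1) 1 U).minEnergyOn
              (szSector (2 * ⌊(1 - δ) * ((n + 1 : ℕ) : ℝ) ^ 2 / 2⌋₊) 0) + ε) *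
              (star w ⬝ᵥ w).re) →
          ∀ w ∈ W, c * ((n + 1 : ℕ) : ℝ) ^ 4 * (star w ⬝ᵥ w).re ≤
            (expect ((pairField dWaveFormFactor (n + 1))ᴴ * pairField dWaveFormFactor (n + 1))
              w).re) :
    HubbardSuperconductivity := by
  obtain ⟨U, hU, δ, hδ, c, hc, L₀, hb⟩ := h
  refine hubbardSuperconductivity_of_uniform_dWave_bound ⟨U, hU, δ, hδ, c, hc, L₀, ?_⟩
  intro n hn hL φ hφ1 hφ
  obtain ⟨ε, hε, hwin⟩ := hb n hn hL
  set H := hubbardTorus 2 (n + 1) 1 U with hH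
  set S := szSector (Λ := FermionTorus 2 (n + 1)) (2 * ⌊(1 - δ) * ((n + 1 : ℕ) : ℝ) ^ 2 / 2⌋₊) 0
    with hS
  set E₀ := H.minEnergyOn S with hE₀
  -- the ground eigenspace is an admissible window (`ε ≥ 0`)
  let V : Submodule ℂ (Fock (Orb (FermionTorus 2 (n + 1)))) :=
    { carrier := {ψ | ψ ∈ S ∧ H *ᵥ ψ = ((E₀ : ℝ) : ℂ) • ψ}
      zero_mem' := ⟨S.zero_mem, by rw [mulVec_zero, smul_zero]⟩
      add_mem' := by
        rintro a b ⟨ha, ha'⟩ ⟨hb, hb'⟩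
        exact ⟨S.add_mem ha hb, by rw [mulVec_add, ha', hb', smul_add]⟩
      smul_mem' := by
        rintro k a ⟨ha, ha'⟩
        exact ⟨S.smul_mem k ha, by rw [mulVec_smul, ha', smul_comm]⟩ }
  have hVle : V ≤ S := fun ψ hψ => hψ.1
  have hVinv : ∀ w ∈ V, H *ᵥ w ∈ V := by
    rintro w ⟨hw, hw'⟩
    rw [hw']
    exact V.smul_mem _ ⟨hw, hw'⟩
  have hVlow : ∀ w ∈ V, (star w ⬝ᵥ (H *ᵥ w)).re ≤ (E₀ + ε) * (star w ⬝ᵥ w).re := by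
    rintro w ⟨-, hw'⟩
    rw [hw', dotProduct_smul, smul_eq_mul, Complex.re_ofReal_mul]
    have hw0 := (Complex.nonneg_iff.mp (dotProduct_star_self_nonneg w)).1
    nlinarith
  have h := hwin V hVle hVinv hVlow φ ⟨hφ.1, hφ.2.2⟩
  rw [hφ1, Complex.one_re, mul_one] at h
  exact h

end Hubbard

end Summit.HubbardSuperconductivity.HubbardSuperconductivity.Theorems
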